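import Summits.HodgeConjecture.HodgeConjecture.Theses.CyclicUnitaryPowers
import Literature.AlgebraicGeometry.HodgeTheory.BettiUniverseAxioms
import Literature.AlgebraicGeometry.HodgeTheory.ComplexConjugationHolds
import Literature.AlgebraicGeometry.HodgeTheory.HodgeFiltrationModelsReductionProofs
import Literature.AlgebraicGeometry.HodgeTheory.HodgeTypeProjectors

/-!
# K2 trace-form orthogonality (route `CyclicUnitaryPowers`, item stmt-HodgeConjecture-19545)

Discharges the registered stub `stub_traceFormHodgeOrthogonal` (skeleton `3dcaec2ceafa0764`, K2 line
`unitary-kunneth-fft`) of crux `PowersHodgeOfDeckCommutators` (rank 3) of route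
`route-HodgeConjecture-CyclicUnitaryPowers`; landed `--supports stmt-HodgeConjecture-19545` (it does not
close the item). Sorry-free.

## Statement

`stub_traceFormHodgeOrthogonal` (registered signature verbatim): on a smooth projective SURFACE `X`,
the complexified trace form `(x, y) ↦ tr(x ∪ y)` on `ℂ ⊗_ℚ H²(X(ℂ); ℚ)` vanishes on `Fᵃ × Fᵇ` as soon as
`a + b ≥ 3`: `x ∈ Fᵃ H², y ∈ Fᵇ H² ⇒ tr_ℂ(x ∪ y) = 0` (so `H^{2,0} ⊥ H^{2,0} ⊕ H^{1,1}`, `F¹ ⊥ F²`).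

## Proof

`cup2_hodge` (Voisin I Thm. 5.29 / §7.1.2, in the tree): `x ∪ y ∈ F^{a+b} H⁴(X) ⊆ F³ H⁴(X)`; and
`hodge_F_eq_bot_of_lt`: `Fʳ Hᵏ(X) = 0` for `r > dim X` (no `(p, q)`-classes with `p > dim X`,
`hodgePQ_eq_bot_of_finrank_lt_fst`), so `x ∪ y = 0` in `ℂ ⊗ H⁴`; finally the complexified trace FORM of
`(∪).compr₂ tr` is the complexified trace applied to the complexified cup product
(`bilinForm_baseChange_compr₂_apply`, checked on pure tensors).

## References

* [VoisinHodgeI2002] C. Voisin, Hodge Theory and Complex Algebraic Geometry I, CUP 2002, §5.3.2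
  Thm. 5.29, §6.1, §7.1.1–7.1.2.
-/

noncomputable section

namespace Summit.HodgeConjecture.HodgeConjecture.Theorems.CyclicUnitaryPowersTraceFormHodgeOrthogonal

open scoped TensorProduct
open Literature.AlgebraicGeometry.Motives Literature.AlgebraicGeometry.HodgeTheory
open Literature.AlgebraicGeometry.HodgeTheory.BettiUniverse
open Literature.AlgebraicTopology.SingularHomology
open CategoryTheory

/-- **`Fʳ Hᵏ(X) = 0` for `r > dim X`**: every piece `H^{p,k-p}` with `p ≥ r > n` vanishes on the
`n`-dimensional `X^an`. [cite: VoisinHodgeI2002, §6.1 and §7.1.1] -/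
theorem hodge_F_eq_bot_of_lt {n : ℕ} {X : SchemeOver ℂ} (hHD : exists_isReal_hodgeModel)
    (hX : IsSmoothProjective n X) (k : ℕ) {r : ℤ} (hr : (n : ℤ) < r) :
    (hodge hHD hX k).F r = ⊥ := by
  rw [hodge_F, HodgeModel.ratF_eq_iSup]
  refine le_bot_iff.1 (iSup_le fun pq ↦ iSup_le fun hpq ↦ le_of_eq ?_)
  have hbot : (realHodgeModel hHD hX).hodgePQ k pq.1.1 pq.1.2 = ⊥ :=
    ((realHodgeModel hHD hX).hodgePQ_eq_bot_iff k pq.1.1 pq.1.2).2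
      (Literature.NumberTheory.Transcendental.hodgePQ_eq_bot_of_finrank_lt_fst
        (realHodgeModel hHD hX).carrier
        (by rw [(realHodgeModel hHD hX).isAnalytification.finrank_eq]; omega))
  rw [HodgeModel.ratPiece, hbot, Submodule.comap_bot, LinearEquiv.ker]

/-- The complexified bilinear FORM `(B.compr₂ t)_ℂ` is `t_ℂ` applied to the complexified bilinear MAP
`B_ℂ` (read in `ℂ ⊗_ℚ ℚ = ℂ`). [folklore] -/
theorem bilinForm_baseChange_compr₂_apply {M N : Type*} [AddCommGroup M] [Module ℚ M]
    [AddCommGroup N] [Module ℚ N] (B : M →ₗ[ℚ] M →ₗ[ℚ] N) (t : N →ₗ[ℚ] ℚ) (x y : ℂ ⊗[ℚ] M) :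
    LinearMap.BilinForm.baseChange ℂ (B.compr₂ t) x y =
      TensorProduct.AlgebraTensorModule.rid ℚ ℂ ℂ
        ((t.baseChange ℂ) (LinearMap.BilinMap.baseChange ℂ B x y)) := by
  induction x using TensorProduct.induction_on generalizing y with
  | zero => rw [map_zero, LinearMap.zero_apply, map_zero, LinearMap.zero_apply, map_zero, map_zero]
  | tmul a m =>
    induction y using TensorProduct.induction_on with
    | zero => rw [map_zero, map_zero, map_zero, map_zero]
    | tmul a' m' =>
      rw [LinearMap.BilinForm.baseChange_tmul, LinearMap.BilinMap.baseChange_tmul,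
        LinearMap.baseChange_tmul, TensorProduct.AlgebraTensorModule.rid_tmul, LinearMap.compr₂_apply]
    | add y y' hy hy' => rw [map_add, map_add, map_add, map_add, hy, hy']
  | add x x' hx hx' =>
    rw [map_add, LinearMap.add_apply, hx, hx', map_add, LinearMap.add_apply, map_add, map_add]

/-- **`stub_traceFormHodgeOrthogonal`** (registered signature verbatim): `tr_ℂ(x ∪ y) = 0` for
`x ∈ Fᵃ H²(X)`, `y ∈ Fᵇ H²(X)`, `a + b ≥ 3`, `X` a smooth projective surface.
[cite: VoisinHodgeI2002, §5.3.2 Thm. 5.29, §6.1 and §7.1.2] -/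
theorem stub_traceFormHodgeOrthogonal :
    open Literature.AlgebraicGeometry.Motives Literature.AlgebraicGeometry.HodgeTheory Literature.AlgebraicGeometry.HodgeTheory.BettiUniverse CategoryTheory.Limits in ∀ ⦃X : SchemeOver ℂ⦄ (hX : IsSmoothProjective 2 X) (a b : ℤ) (x y : ℂ ⊗[ℚ] bettiCohomology X 2), x ∈ (hodge exists_isReal_hodgeModel_holds hX 2).F a → y ∈ (hodge exists_isReal_hodgeModel_holds hX 2).F b → 3 ≤ a + b → LinearMap.BilinForm.baseChange ℂ ((cup X 2 2).compr₂ (tr hX (2 + 2))) x y = 0 := by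
  intro X hX a b x y hx hy hab
  have hz : LinearMap.BilinMap.baseChange ℂ (cup X 2 2) x y = 0 := by
    have h := cup2_hodge exists_isReal_hodgeModel_holds hodgePQ_independent_of_hodgeModel_holds hX 2 a b
      x y hx hy
    have h' := (hodge exists_isReal_hodgeModel_holds hX (2 + 2)).antitone_F hab h
    rwa [hodge_F_eq_bot_of_lt exists_isReal_hodgeModel_holds hX (2 + 2) (r := 3) (by norm_num),
      Submodule.mem_bot] at h'
  rw [bilinForm_baseChange_compr₂_apply, hz, map_zero, map_zero]

end Summit.HodgeConjecture.HodgeConjecture.Theorems.CyclicUnitaryPowersTraceFormHodgeOrthogonal
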